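import Literature.LinearAlgebra.Matrix.CyclicBlockDeterminant
import HarnessLib

/-!
# Splitting the transfer product of a reflection-symmetric time circle

For a time circle of even length `2T` (`Fin (T + T)`, `T = h + 1`) carrying matrices
`Λ_t` ("temporal link blocks") and Hermitian `Y_t` ("transfer steps"), the ordered product
`𝒫 = Λ_{2T-1}ᴴ Y_{2T-1} ⋯ Λ₀ᴴ Y₀` splits at the two reflection slices `0` and `T` as
`𝒫 = (𝔓ʳ)ᴴ · Y_T · 𝔓 · Y₀` (`reverse_prod_transfer_reflect`), where
`𝔓 = halfTransfer Λ Y = Λ_{T-1}ᴴ Y_{T-1} ⋯ Λ₁ᴴ Y₁ Λ₀ᴴ` is the transfer product of the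
POSITIVE half and `𝔓ʳ = halfTransfer Λʳ Yʳ` that of the reflected families
`Λʳ_t = (Λ_{-t-1})ᴴ`, `Yʳ_t = Y_{-t}` (the blocks of a gauge field reflected in the lattice
hyperplanes `t = 0, T`). This is the bookkeeping behind marginal site-reflection positivity of
fermion determinants: with `det_one_add_eq_sum_gram` it exhibits `det (1 + 𝒫)` as a positive
semidefinite Gram kernel in (positive half, reflected positive half). All statements are proved.
[folklore]
-/

noncomputable section

namespace Literature.LinearAlgebra.Matrix

open _root_.Matrix

/-! ### Ordered products: reversal and a forward telescope -/

section Lists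

variable {M : Type*} [Monoid M]

omit [Monoid M] in
/-- Reversing an `ofFn` list is re-indexing by `Fin.rev`. [folklore] -/
theorem reverse_ofFn_eq_ofFn_rev : ∀ {k : ℕ} (g : Fin k → M),
    (List.ofFn g).reverse = List.ofFn fun i => g (Fin.rev i)
  | 0, g => by simp
  | k + 1, g => by
    rw [List.ofFn_succ' g, List.concat_eq_append, List.reverse_append, List.reverse_singleton,
      List.singleton_append, reverse_ofFn_eq_ofFn_rev, List.ofFn_succ]
    simp only [Fin.rev_zero, Fin.rev_succ]

/-- **Forward telescope**: `B₀ · ∏ⱼ (Aⱼ B'ⱼ) = ∏ⱼ (Bⱼ Aⱼ)` when `B'ⱼ = B_{j+1}` for `j < k` and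
`B'_k = 1`. [folklore] -/
theorem mul_prod_ofFn_telescope : ∀ {k : ℕ} (A B B' : Fin (k + 1) → M)
    (_ : ∀ i : Fin k, B' i.castSucc = B i.succ) (_ : B' (Fin.last k) = 1),
    B 0 * (List.ofFn fun j : Fin (k + 1) => A j * B' j).prod = (List.ofFn fun j => B j * A j).prod
  | 0, A, B, B', _, hlast => by
    have h0 : B' 0 = 1 := hlast
    simp [List.ofFn_succ, h0]
  | k + 1, A, B, B', hB', hlast => by
    rw [List.ofFn_succ, List.prod_cons, List.ofFn_succ (f := fun j => B j * A j), List.prod_cons,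
      show B' 0 = B 1 from hB' 0, ← mul_assoc, ← mul_assoc, mul_assoc (B 0 * A 0)]
    congr 1
    rw [← Fin.succ_zero_eq_one]
    exact mul_prod_ofFn_telescope (fun i => A i.succ) (fun i => B i.succ) (fun i => B' i.succ)
      (fun i => by rw [Fin.succ_castSucc, hB']) (by rw [Fin.succ_last, hlast])

end Lists

/-! ### Index arithmetic on the doubled circle `Fin (T + T)` -/

section Indices

variable {h : ℕ}

/-- Three elements of `Fin m` whose values add up to `m` sum to zero. [folklore] -/
theorem add_add_eq_zero_of_val {m : ℕ} [NeZero m] {a b c : Fin m} (habc : a.val + b.val + c.val = m) :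
    a + b + c = 0 := by
  refine Fin.ext ?_
  rw [Fin.val_add, Fin.val_add, Nat.mod_add_mod, habc, Nat.mod_self, Fin.val_zero]

/-- Two elements of `Fin m` whose values add up to `m` sum to zero. [folklore] -/
theorem add_eq_zero_of_val {m : ℕ} [NeZero m] {a b : Fin m} (hab : a.val + b.val = m) : a + b = 0 := by
  refine Fin.ext ?_
  rw [Fin.val_add, hab, Nat.mod_self, Fin.val_zero]

/-- `-s - 1 = T + (T - 1 - s)` on the circle of length `2T`, `T = h + 1`, `s < T`. [folklore] -/
theorem neg_castLE_sub_one (s : Fin (h + 1)) :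
    -(Fin.castLE (Nat.le_add_right (h + 1) (h + 1)) s) - 1 = Fin.natAdd (h + 1) (Fin.rev s) := by
  have h1 : ((1 : Fin (h + 1 + (h + 1))) : ℕ) = 1 := by
    rw [Fin.val_one', Nat.mod_eq_of_lt (by omega)]
  have hsum : Fin.natAdd (h + 1) (Fin.rev s) + 1 + Fin.castLE (Nat.le_add_right (h + 1) (h + 1)) s = 0 := by
    refine add_add_eq_zero_of_val ?_
    rw [h1]
    simp [Fin.val_rev]
    omega
  exact (eq_sub_of_add_eq (eq_neg_of_add_eq_zero_left hsum)).symm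

/-- `-(i+1) = T + (T - 1 - i)` on the circle of length `2T`. [folklore] -/
theorem neg_castLE_succ (i : Fin h) :
    -(Fin.castLE (Nat.le_add_right (h + 1) (h + 1)) i.succ) = Fin.natAdd (h + 1) (Fin.rev (Fin.castSucc i)) := by
  have hsum : Fin.natAdd (h + 1) (Fin.rev (Fin.castSucc i)) +
      Fin.castLE (Nat.le_add_right (h + 1) (h + 1)) i.succ = 0 := by
    refine add_eq_zero_of_val ?_
    simp [Fin.val_rev]
    omega
  exact (eq_neg_of_add_eq_zero_left hsum).symm

/-- The second reflection slice is fixed by the reflection: `-(T + 0) = T + 0`. [folklore] -/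
theorem neg_natAdd_zero :
    -(Fin.natAdd (h + 1) (0 : Fin (h + 1)) : Fin (h + 1 + (h + 1))) = Fin.natAdd (h + 1) 0 := by
  have hsum : (Fin.natAdd (h + 1) (0 : Fin (h + 1)) : Fin (h + 1 + (h + 1))) + Fin.natAdd (h + 1) 0 = 0 := by
    refine add_eq_zero_of_val ?_
    simp
  exact (eq_neg_of_add_eq_zero_left hsum).symm

/-- `castLE 0 = 0`. [folklore] -/
theorem castLE_zero : (Fin.castLE (Nat.le_add_right (h + 1) (h + 1)) 0 : Fin (h + 1 + (h + 1))) = 0 :=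
  Fin.ext rfl

end Indices

/-! ### The half transfer product and the splitting of the full product -/

section Transfer

variable {ι : Type*} [Fintype ι] [DecidableEq ι] {R : Type*} [CommRing R] [StarRing R] {h : ℕ}

/-- **The transfer product of the positive half** of the doubled time circle `Fin (T + T)`,
`T = h + 1`: `𝔓 = Λ_{T-1}ᴴ Y_{T-1} ⋯ Λ₁ᴴ Y₁ Λ₀ᴴ` (the step `Y₀` of the reflection slice is NOT
included; it is supplied separately in `reverse_prod_transfer_reflect`). [folklore] -/
def halfTransfer (h : ℕ) (Λ Y : Fin (h + 1 + (h + 1)) → Matrix ι ι R) : Matrix ι ι R :=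
  (List.ofFn fun s : Fin (h + 1) => (Λ (Fin.castLE (Nat.le_add_right (h + 1) (h + 1)) s))ᴴ *
    (if (s : ℕ) = 0 then 1 else Y (Fin.castLE (Nat.le_add_right (h + 1) (h + 1)) s))).reverse.prod

/-- The first half of the full product is `𝔓 · Y₀`. [folklore] -/
theorem reverse_prod_ofFn_castLE (Λ Y : Fin (h + 1 + (h + 1)) → Matrix ι ι R) :
    (List.ofFn fun s : Fin (h + 1) => (Λ (Fin.castLE (Nat.le_add_right (h + 1) (h + 1)) s))ᴴ *
      Y (Fin.castLE (Nat.le_add_right (h + 1) (h + 1)) s)).reverse.prod = halfTransfer h Λ Y * Y 0 := by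
  rw [halfTransfer, reverse_prod_ofFn_succ, reverse_prod_ofFn_succ]
  simp only [Fin.val_succ, Nat.succ_ne_zero, ↓reduceIte, Fin.val_zero, Matrix.mul_one, Matrix.mul_assoc,
    castLE_zero]

/-- The second half of the full product is `(𝔓ʳ)ᴴ · Y_T` for the reflected families. [folklore] -/
theorem reverse_prod_ofFn_natAdd (Λ Y Λr Yr : Fin (h + 1 + (h + 1)) → Matrix ι ι R)
    (hY : ∀ t, (Y t)ᴴ = Y t) (hYr : ∀ t, Yr t = Y (-t)) (hΛr : ∀ t, Λr t = (Λ (-t - 1))ᴴ) :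
    (List.ofFn fun j : Fin (h + 1) => (Λ (Fin.natAdd (h + 1) j))ᴴ * Y (Fin.natAdd (h + 1) j)).reverse.prod =
      (halfTransfer h Λr Yr)ᴴ * Y (Fin.natAdd (h + 1) 0) := by
  rw [← Matrix.conjTranspose_inj]
  -- left-hand side: a forward product
  rw [Matrix.conjTranspose_list_prod, List.map_reverse, List.reverse_reverse, List.map_ofFn,
    Matrix.conjTranspose_mul, Matrix.conjTranspose_conjTranspose, hY]
  -- right-hand side
  rw [halfTransfer, reverse_ofFn_eq_ofFn_rev]
  simp only [Function.comp_def, Matrix.conjTranspose_mul, Matrix.conjTranspose_conjTranspose, hY, hΛr, hYr,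
    neg_castLE_sub_one, Fin.rev_rev]
  refine (mul_prod_ofFn_telescope (fun j => Λ (Fin.natAdd (h + 1) j)) (fun j => Y (Fin.natAdd (h + 1) j))
    (fun j => if ((Fin.rev j : Fin (h + 1)) : ℕ) = 0 then 1 else Y (-Fin.castLE (Nat.le_add_right (h + 1) (h + 1)) (Fin.rev j)))
    (fun i => ?_) ?_).symm.trans ?_
  · rw [Fin.rev_castSucc, if_neg (by simp), neg_castLE_succ, Fin.rev_castSucc, Fin.rev_rev]
  · rw [Fin.rev_last]
    exact if_pos rfl
  · rfl

/-- **Splitting of the transfer product of a reflection-symmetric circle at the two reflection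
slices.** For Hermitian `Y_t` and the reflected families `Yʳ_t = Y_{-t}`, `Λʳ_t = (Λ_{-t-1})ᴴ`,
`Λ_{2T-1}ᴴ Y_{2T-1} ⋯ Λ₀ᴴ Y₀ = (𝔓ʳ)ᴴ · Y_T · 𝔓 · Y₀` with `𝔓 = halfTransfer Λ Y`,
`𝔓ʳ = halfTransfer Λʳ Yʳ`, `T = h + 1` the second reflection slice. [folklore] -/
theorem reverse_prod_transfer_reflect (Λ Y Λr Yr : Fin (h + 1 + (h + 1)) → Matrix ι ι R)
    (hY : ∀ t, (Y t)ᴴ = Y t) (hYr : ∀ t, Yr t = Y (-t)) (hΛr : ∀ t, Λr t = (Λ (-t - 1))ᴴ) :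
    (List.ofFn fun t => (Λ t)ᴴ * Y t).reverse.prod =
      (halfTransfer h Λr Yr)ᴴ * Y (Fin.natAdd (h + 1) 0) * halfTransfer h Λ Y * Y 0 := by
  rw [List.ofFn_add, List.reverse_append, List.prod_append, reverse_prod_ofFn_natAdd Λ Y Λr Yr hY hYr hΛr,
    reverse_prod_ofFn_castLE, Matrix.mul_assoc, Matrix.mul_assoc, Matrix.mul_assoc]

end Transfer

end Literature.LinearAlgebra.Matrix

end
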